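import Literature.NumberTheory.Automorphic.CompactCoreLevelPoint
import Literature.NumberTheory.Automorphic.LocalOrbitalMeasureSemisimple
import Literature.NumberTheory.Rogawski1990.MatchingAdeleGKConjSemisimple
import Literature.NumberTheory.Rogawski1990.AdelicStableConjugacyG
import HarnessLib

/-!
# The LEVEL-NORMALISED class-indexed family of local orbital measures of `U(H)(L⁺_v)` at EVERY SEMISIMPLE rational class
# (regular, singular, central), normalised at each rational point off finitely many places
(Rogawski (1990), §4.3 pp. 43–44, §4.9 p. 54; Kottwitz (1986), Prop. 7.1 ∕ §7.3; Deitmar–Echterhoff (2014), Thm. 1.5.3)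

Topic `NumberTheory/Automorphic`; namespaces `Literature.NumberTheory.Automorphic` (§1, generic locally compact groups) and `….UnitaryGroup` (§2).
THEOREMS ONLY (no definition, no instance, no named fact, no `sorry`).  Cell `pub/hodgecm-mathlib`, ENGINE T1 line `F0_T1InnerFormTraceIdentity`
(crux item stmt-HodgeConjecture-24833), row (O10-s) FILE B of F0P3a-p06 (g5); companion of ★-to-be FILE A `UnitaryGroupOfLocalCentralizerMeasureKit`
(`exists_tower_ofLocal_eq_quotientMeasure_of_atPoint_eq`), whose point data `t, hat, hadm, S₀, ht1K` this file PRODUCES at every semisimple rational class.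

WHY LEVEL, NOT COMPACT CORE.  The T1 line pins its local families CANONICAL on the REGULAR classes (★ `OrbitalMeasureFamily.IsCanonical`: the
centraliser measure normalised by `t(compactCore C(γ)) = 1`).  At a SINGULAR semisimple class this normalisation is unavailable — at a split place
the centraliser `GL₂(F_v) × GL₁(F_v)` of an element with eigenvalues `{a, a, b}` has a compact core of infinite Haar measure (SPEC-O7 erratum (ix-s),
O7 OWNER WORD #13).  What ★ `UnitaryGroup.IsNormalisedOff` literally reads at a rational point `γ_v` is the LEVEL mass:
`(mG v).atPoint γ_v (π K_v) = ν_v(K_v) ∕ t_v(C(γ_v) ∩ K_v)`.  So here the centraliser measures are normalised by `t_v(C(γ_v) ∩ K_v) = 1`,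
`K_v = U(H)(𝒪_v)` — which for ONE class-indexed family must be CONSISTENT across all rational points sharing a local class: that consistency is
exactly integral conjugacy («`U(H)(L⁺_v)`-conjugate points of `K_v` are `K_v`-conjugate», ★ `Rogawski1990.eventually_forall_integralConj_cmDatum_of_isSemisimpleElt`,
Kottwitz's Prop. 7.1 at all three kinds of semisimple element), through the factorisation `x = k z`, `k ∈ K_v`, `z ∈ C(γ₀,v)` of the conjugator and the
conjugation invariance of a two-sided Haar measure on the unimodular centraliser (★ `isMulRightInvariant_local_centralizer_toLocal_of_isSemisimpleElt`).

* §1 GENERIC (`G` locally compact, second countable, `ν` two-sided Haar, `K ≤ G` compact open, `P ⊆ G` points with unimodular centralisers):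
  `exists_isHaarMeasure_centralizer_preimage_eq_one` (a two-sided Haar measure on `C(γ)` with `t(C(γ) ∩ K) = 1`),
  `map_subgroupCongrHomeomorph_conj_apply_preimage_eq` (the level mass is unchanged by transport along `conj (k z)`),
  `isHaarMeasure_isInvInvariant_map_subgroupCongrHomeomorph_conj` (transport package),
  **`exists_orbitalMeasureFamily_atPoint_eq_quotientMeasure_levelNormalised`** (the class-indexed family: admissible member, `atPoint g = ν ∕ t`,
  and `t(C(g) ∩ K) = 1` at every integral `P`-point with the integral-conjugacy property).
* §2 `U(H)`, `H ∈ M₃(L)` hermitian non-degenerate, every finite `v`: **`UnitaryGroup.exists_localOrbitalMeasureFamily_levelNormalised_of_isSemisimpleElt`**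
  (per `v`) and **`UnitaryGroup.exists_localOrbitalMeasureFamilies_levelNormalised_of_isSemisimpleElt`** (all `v` at once, with the finite
  exceptional set `S₀(γ)` of each semisimple rational `γ` — the `t, hat, hadm, S₀, ht1K` of FILE A).
HC_CM is proved only modulo the printed citations until rung 0 closes; this file proves no printed citation (measure-theoretic plumbing over ★ K6-α).

## References
* J. D. Rogawski, *Automorphic Representations of Unitary Groups in Three Variables* (1990), §4.3 pp. 43–44, §4.9 p. 54 [Rogawski1990].
* R. E. Kottwitz, *Stable trace formula: elliptic singular terms*, Math. Ann. 275 (1986), Prop. 7.1, §7.3 [Kottwitz1986].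
* A. Deitmar, S. Echterhoff, *Principles of Harmonic Analysis* (2nd ed. 2014), Thm. 1.5.3 [DeitmarEchterhoff2014].
* S. Gelbart, *Automorphic forms on adele groups* (1975), (9.13) [Gelbart1975].
-/

set_option autoImplicit false

noncomputable section

open MeasureTheory Measure Set Topology NumberField IsDedekindDomain Filter
open Literature.MeasureTheory.Group
open scoped ENNReal NNReal Pointwise Matrix

namespace Literature.NumberTheory.Automorphic

/-! ## §1 Generic: level-normalised centraliser measures and the class-indexed family they define -/

section Generic

variable {G : Type*} [Group G] [TopologicalSpace G] [IsTopologicalGroup G] [LocallyCompactSpace G]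
  [SecondCountableTopology G] [T2Space G] [MeasurableSpace G] [BorelSpace G]

/-- **A Haar measure on the centraliser `C(γ)` normalised by LEVEL**: for a compact open subgroup `K ≤ G` there is a Haar measure `t` on `C(γ)`
with `t(C(γ) ∩ K) = 1` (the Haar measure of the positive compact `C(γ) ∩ K`); it is inversion invariant as soon as `C(γ)` is unimodular.
[cite: DeitmarEchterhoff2014, Thm. 1.5.3] [cite: Rogawski1990, §4.3 p. 43] -/
theorem exists_isHaarMeasure_centralizer_preimage_eq_one (γ : G) (K : Subgroup G) (hK : IsOpen (K : Set G))
    (hKc : IsCompact (K : Set G))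
    (hU : ∀ (ρ : Measure (Subgroup.centralizer ({γ} : Set G))) [ρ.IsHaarMeasure], ρ.IsMulRightInvariant) :
    ∃ t : Measure (Subgroup.centralizer ({γ} : Set G)), ∃ (_ : t.IsHaarMeasure) (_ : t.IsInvInvariant),
      t (Subtype.val ⁻¹' (K : Set G)) = 1 := by
  haveI hZc : IsClosed ((Subgroup.centralizer ({γ} : Set G) : Subgroup G) : Set G) := isClosed_coe_centralizer_singleton γ
  haveI : LocallyCompactSpace (Subgroup.centralizer ({γ} : Set G)) := hZc.isClosedEmbedding_subtypeVal.locallyCompactSpace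
  haveI : SecondCountableTopology (Subgroup.centralizer ({γ} : Set G)) := TopologicalSpace.Subtype.secondCountableTopology _
  have hKo : IsOpen (Subtype.val ⁻¹' (K : Set G) : Set (Subgroup.centralizer ({γ} : Set G))) := hK.preimage continuous_subtype_val
  let K₀ : TopologicalSpace.PositiveCompacts (Subgroup.centralizer ({γ} : Set G)) :=
    ⟨⟨Subtype.val ⁻¹' (K : Set G), hZc.isClosedEmbedding_subtypeVal.isCompact_preimage hKc⟩, by
      show (interior (Subtype.val ⁻¹' (K : Set G) : Set (Subgroup.centralizer ({γ} : Set G)))).Nonempty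
      rw [hKo.interior_eq]
      exact ⟨1, K.one_mem⟩⟩
  haveI : (Measure.haarMeasure K₀).IsMulRightInvariant := hU _
  refine ⟨Measure.haarMeasure K₀, inferInstance, isInvInvariant_of_isMulRightInvariant _, ?_⟩
  exact Measure.haarMeasure_self

variable [∀ γ : G, MeasurableSpace (G ⧸ Subgroup.centralizer ({γ} : Set G))]
  [∀ γ : G, BorelSpace (G ⧸ Subgroup.centralizer ({γ} : Set G))]

omit [LocallyCompactSpace G] [SecondCountableTopology G] [T2Space G]
  [∀ γ : G, MeasurableSpace (G ⧸ Subgroup.centralizer ({γ} : Set G))] [∀ γ : G, BorelSpace (G ⧸ Subgroup.centralizer ({γ} : Set G))] in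
/-- **The level mass is unchanged under a conjugation that factors through `K · C(γ₀)`**: if `x γ₀ x⁻¹ = γ`, `x = k z` with `k ∈ K`, `z ∈ C(γ₀)`, and
`t` is a two-sided Haar measure on `C(γ₀)`, then the transport of `t` to `C(γ)` along `conj x` gives `C(γ) ∩ K` the mass `t(C(γ₀) ∩ K)` (the preimage
is `z⁻¹ (C(γ₀) ∩ K) z`, and `t` is conjugation invariant, ★ `map_mulAutConj_eq_self`). [cite: DeitmarEchterhoff2014, Thm. 1.5.3] [cite: Kottwitz1986, §7.3] -/
theorem map_subgroupCongrHomeomorph_conj_apply_preimage_eq (γ₀ γ x : G) (hx : (MulAut.conj x : G ≃* G) γ₀ = γ) (K : Subgroup G)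
    (hK : IsOpen (K : Set G)) (k : G) (hk : k ∈ K) (hkx : k⁻¹ * x ∈ Subgroup.centralizer ({γ₀} : Set G))
    (t : Measure (Subgroup.centralizer ({γ₀} : Set G))) [t.IsMulLeftInvariant] [t.IsMulRightInvariant] :
    Measure.map (subgroupCongrHomeomorph (MulAut.conj x : G ≃* G) _ (Subgroup.centralizer ({γ} : Set G))
        (forall_apply_mem_centralizer_singleton_iff_of_eq (MulAut.conj x) hx) (continuous_mulAutConj x) (continuous_mulAutConj_symm x)) t
      (Subtype.val ⁻¹' (K : Set G)) = t (Subtype.val ⁻¹' (K : Set G)) := by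
  set z : Subgroup.centralizer ({γ₀} : Set G) := ⟨k⁻¹ * x, hkx⟩ with hz
  have hKm : MeasurableSet (Subtype.val ⁻¹' (K : Set G) : Set (Subgroup.centralizer ({γ} : Set G))) :=
    (hK.preimage continuous_subtype_val).measurableSet
  have hKm₀ : MeasurableSet (Subtype.val ⁻¹' (K : Set G) : Set (Subgroup.centralizer ({γ₀} : Set G))) :=
    (hK.preimage continuous_subtype_val).measurableSet
  rw [← Homeomorph.toMeasurableEquiv_coe, MeasurableEquiv.map_apply, Homeomorph.toMeasurableEquiv_coe]
  have hpre : (subgroupCongrHomeomorph (MulAut.conj x : G ≃* G) _ (Subgroup.centralizer ({γ} : Set G))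
        (forall_apply_mem_centralizer_singleton_iff_of_eq (MulAut.conj x) hx) (continuous_mulAutConj x) (continuous_mulAutConj_symm x)) ⁻¹'
        (Subtype.val ⁻¹' (K : Set G)) =
      (MulAut.conj z : Subgroup.centralizer ({γ₀} : Set G) ≃* Subgroup.centralizer ({γ₀} : Set G)) ⁻¹' (Subtype.val ⁻¹' (K : Set G)) := by
    ext w
    simp only [Set.mem_preimage, SetLike.mem_coe, coe_subgroupCongrHomeomorph_apply, MulAut.conj_apply, Subgroup.coe_mul,
      Subgroup.coe_inv, hz]
    constructor
    · intro h
      have h' := K.mul_mem (K.mul_mem (K.inv_mem hk) h) hk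
      convert h' using 1
      group
    · intro h
      have h' := K.mul_mem (K.mul_mem hk h) (K.inv_mem hk)
      convert h' using 1
      group
  rw [hpre, ← Measure.map_apply (continuous_mulAutConj z).measurable hKm₀, map_mulAutConj_eq_self t z]

omit [LocallyCompactSpace G] [SecondCountableTopology G] [T2Space G]
  [∀ γ : G, MeasurableSpace (G ⧸ Subgroup.centralizer ({γ} : Set G))] [∀ γ : G, BorelSpace (G ⧸ Subgroup.centralizer ({γ} : Set G))] in
/-- **Transport of a two-sided Haar measure on `C(γ₁)` to `C(γ₂)` along `conj x`** (`x γ₁ x⁻¹ = γ₂`) is a Haar measure and inversion invariant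
(`conj x` restricts to an isomorphism of topological groups `C(γ₁) ≃ₜ* C(γ₂)`; Mathlib `MulEquiv.isHaarMeasure_map`, ★ `isInvInvariant_map_mulEquiv`).
[cite: DeitmarEchterhoff2014, Thm. 1.5.3] -/
theorem isHaarMeasure_isInvInvariant_map_subgroupCongrHomeomorph_conj (γ₁ γ₂ x : G) (hx : (MulAut.conj x : G ≃* G) γ₁ = γ₂)
    (t : Measure (Subgroup.centralizer ({γ₁} : Set G))) [t.IsHaarMeasure] [t.IsInvInvariant] :
    (Measure.map (subgroupCongrHomeomorph (MulAut.conj x : G ≃* G) _ (Subgroup.centralizer ({γ₂} : Set G))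
        (forall_apply_mem_centralizer_singleton_iff_of_eq (MulAut.conj x) hx) (continuous_mulAutConj x) (continuous_mulAutConj_symm x)) t).IsHaarMeasure ∧
      (Measure.map (subgroupCongrHomeomorph (MulAut.conj x : G ≃* G) _ (Subgroup.centralizer ({γ₂} : Set G))
        (forall_apply_mem_centralizer_singleton_iff_of_eq (MulAut.conj x) hx) (continuous_mulAutConj x) (continuous_mulAutConj_symm x)) t).IsInvInvariant := by
  let eH : Subgroup.centralizer ({γ₁} : Set G) ≃ₜ Subgroup.centralizer ({γ₂} : Set G) :=
    subgroupCongrHomeomorph (MulAut.conj x : G ≃* G) _ _ (forall_apply_mem_centralizer_singleton_iff_of_eq (MulAut.conj x) hx)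
      (continuous_mulAutConj x) (continuous_mulAutConj_symm x)
  let eZ : Subgroup.centralizer ({γ₁} : Set G) ≃ₜ* Subgroup.centralizer ({γ₂} : Set G) :=
    { toMulEquiv :=
        { toEquiv := eH.toEquiv
          map_mul' := fun a b => Subtype.ext (map_mul (MulAut.conj x : G ≃* G) (a : G) (b : G)) }
      continuous_toFun := eH.continuous
      continuous_invFun := eH.symm.continuous }
  have heZ : (eZ : _ → Subgroup.centralizer ({γ₂} : Set G)) = eH := rfl
  exact ⟨MulEquiv.isHaarMeasure_map t eZ.toMulEquiv eZ.continuous eZ.symm.continuous,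
    isInvInvariant_map_mulEquiv eZ.toMulEquiv eZ.continuous.measurable t⟩

/-- **THE LEVEL-NORMALISED CLASS-INDEXED FAMILY (generic)**.  `G` unimodular-enough data: `ν` a two-sided Haar measure, `K ≤ G` compact open, `P` a
set of «good» points whose centralisers are unimodular (`hU`).  There is a class-indexed family `m : OrbitalMeasureFamily G` such that at every
`P`-point `g`: the member `m ⟦g⟧` is non-zero, `G`-invariant and finite on compacta, `m.atPoint g = ν ∕ t` for a Haar inversion-invariant `t` on
`C(g)`, AND `t (C(g) ∩ K) = 1` whenever `g ∈ K` and `g` has the integral-conjugacy property «every `P`-point of `K` conjugate to `g` is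
`K`-conjugate to `g`».  Construction: per class, a base `P`-point `g₀` (IN `K` when the class has one), the Haar measure `t₀` of `C(g₀)` with
`t₀(C(g₀) ∩ K) = 1`, transported to the representative `out c`; consistency at the other integral points of the class is the factorisation
`x = k z` (`k ∈ K`, `z ∈ C(g₀)`) of the conjugator supplied by integral conjugacy. [cite: Kottwitz1986, Prop. 7.1; §7.3]
[cite: DeitmarEchterhoff2014, Thm. 1.5.3] [cite: Rogawski1990, §4.3 pp. 43–44] -/
theorem exists_orbitalMeasureFamily_atPoint_eq_quotientMeasure_levelNormalised (ν : Measure G) [ν.IsHaarMeasure] [ν.IsMulRightInvariant]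
    (K : Subgroup G) (hK : IsOpen (K : Set G)) (hKc : IsCompact (K : Set G)) (P : G → Prop)
    (hU : ∀ g, P g → ∀ (ρ : Measure (Subgroup.centralizer ({g} : Set G))) [ρ.IsHaarMeasure], ρ.IsMulRightInvariant) :
    ∃ m : OrbitalMeasureFamily G, ∀ g, P g →
      (m (ConjClasses.mk g) ≠ 0 ∧
        SMulInvariantMeasure G (G ⧸ Subgroup.centralizer ({(Quotient.out (ConjClasses.mk g) : G)} : Set G)) (m (ConjClasses.mk g)) ∧
        IsFiniteMeasureOnCompacts (m (ConjClasses.mk g))) ∧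
      ∃ t : Measure (Subgroup.centralizer ({g} : Set G)), ∃ (_ : t.IsHaarMeasure) (_ : t.IsInvInvariant),
        m.atPoint g = quotientMeasure (Subgroup.centralizer ({g} : Set G)) t (isClosed_coe_centralizer_singleton g) ν ∧
        (g ∈ K → (∀ g', P g' → g' ∈ K → IsConj g g' → ∃ k ∈ K, k * g * k⁻¹ = g') → t (Subtype.val ⁻¹' (K : Set G)) = 1) := by
  classical
  -- base point of an admissible class: a `P`-point, inside `K` whenever the class meets `K` in a `P`-point
  have hb : ∀ c : ConjClasses G, (∃ g, P g ∧ ConjClasses.mk g = c) →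
      ∃ g₀, P g₀ ∧ ConjClasses.mk g₀ = c ∧ ((∃ g, P g ∧ g ∈ K ∧ ConjClasses.mk g = c) → g₀ ∈ K) := by
    intro c hc
    by_cases h1 : ∃ g, P g ∧ g ∈ K ∧ ConjClasses.mk g = c
    · obtain ⟨g, hP, hgK, hgc⟩ := h1
      exact ⟨g, hP, hgc, fun _ => hgK⟩
    · obtain ⟨g, hP, hgc⟩ := hc
      exact ⟨g, hP, hgc, fun h => absurd h h1⟩
  -- the member at an admissible class, with its transport property
  have hex : ∀ c : ConjClasses G, (∃ g, P g ∧ ConjClasses.mk g = c) →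
      ∃ μ : Measure (G ⧸ Subgroup.centralizer ({(Quotient.out c : G)} : Set G)),
        (μ ≠ 0 ∧ SMulInvariantMeasure G _ μ ∧ IsFiniteMeasureOnCompacts μ) ∧
        ∀ g, P g → ∀ (x : G) (hx : (MulAut.conj x : G ≃* G) (Quotient.out c) = g),
          ∃ t' : Measure (Subgroup.centralizer ({g} : Set G)), ∃ (_ : t'.IsHaarMeasure) (_ : t'.IsInvInvariant),
            Measure.map (cosetCongr (MulAut.conj x : G ≃* G) _ (Subgroup.centralizer ({g} : Set G))
                (forall_apply_mem_centralizer_singleton_iff_of_eq (MulAut.conj x) hx)) μ =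
              quotientMeasure (Subgroup.centralizer ({g} : Set G)) t' (isClosed_coe_centralizer_singleton g) ν ∧
            (g ∈ K → (∀ g', P g' → g' ∈ K → IsConj g g' → ∃ k ∈ K, k * g * k⁻¹ = g') →
              t' (Subtype.val ⁻¹' (K : Set G)) = 1) := by
    intro c hc
    obtain ⟨g₀, hP₀, hc₀, hK₀⟩ := hb c hc
    -- the level-normalised two-sided Haar measure on `C(g₀)`
    obtain ⟨t₀, ht₀H, ht₀I, ht₀1⟩ := exists_isHaarMeasure_centralizer_preimage_eq_one g₀ K hK hKc (hU g₀ hP₀)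
    haveI := ht₀H
    haveI := ht₀I
    haveI : t₀.IsMulRightInvariant := hU g₀ hP₀ t₀
    -- a conjugator `y₀ g₀ y₀⁻¹ = out c`
    have hconj₀ : IsConj g₀ (Quotient.out c) :=
      ConjClasses.mk_eq_mk_iff_isConj.1 (by rw [hc₀, ← ConjClasses.quotient_mk_eq_mk, Quotient.out_eq])
    obtain ⟨y₀, hy₀⟩ := isConj_iff.1 hconj₀
    have hy₀' : (MulAut.conj y₀ : G ≃* G) g₀ = Quotient.out c := by rw [MulAut.conj_apply]; exact hy₀
    -- the member: `ν ∕ (transport of t₀ to C(out c))`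
    haveI hZc : IsClosed ((Subgroup.centralizer ({(Quotient.out c : G)} : Set G) : Subgroup G) : Set G) := isClosed_coe_centralizer_singleton _
    haveI : LocallyCompactSpace (Subgroup.centralizer ({(Quotient.out c : G)} : Set G)) := hZc.isClosedEmbedding_subtypeVal.locallyCompactSpace
    haveI : SecondCountableTopology (Subgroup.centralizer ({(Quotient.out c : G)} : Set G)) := TopologicalSpace.Subtype.secondCountableTopology _
    haveI : SigmaCompactSpace (Subgroup.centralizer ({(Quotient.out c : G)} : Set G)) := sigmaCompactSpace_of_locallyCompact_secondCountable
    obtain ⟨hcH, hcI⟩ := isHaarMeasure_isInvInvariant_map_subgroupCongrHomeomorph_conj g₀ (Quotient.out c) y₀ hy₀' t₀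
    set tc : Measure (Subgroup.centralizer ({(Quotient.out c : G)} : Set G)) :=
      Measure.map (subgroupCongrHomeomorph (MulAut.conj y₀ : G ≃* G) _ (Subgroup.centralizer ({(Quotient.out c : G)} : Set G))
        (forall_apply_mem_centralizer_singleton_iff_of_eq (MulAut.conj y₀) hy₀') (continuous_mulAutConj y₀) (continuous_mulAutConj_symm y₀)) t₀ with htc
    haveI := hcH
    haveI := hcI
    refine ⟨quotientMeasure (Subgroup.centralizer ({(Quotient.out c : G)} : Set G)) tc (isClosed_coe_centralizer_singleton _) ν,
      ⟨quotientMeasure_ne_zero _ _ _ _, smulInvariantMeasure_quotientMeasure _ _ _ _, inferInstance⟩, ?_⟩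
    intro g hP x hx
    haveI hZg : IsClosed ((Subgroup.centralizer ({g} : Set G) : Subgroup G) : Set G) := isClosed_coe_centralizer_singleton g
    haveI : LocallyCompactSpace (Subgroup.centralizer ({g} : Set G)) := hZg.isClosedEmbedding_subtypeVal.locallyCompactSpace
    haveI : SecondCountableTopology (Subgroup.centralizer ({g} : Set G)) := TopologicalSpace.Subtype.secondCountableTopology _
    haveI : SigmaCompactSpace (Subgroup.centralizer ({g} : Set G)) := sigmaCompactSpace_of_locallyCompact_secondCountable
    obtain ⟨hgH, hgI⟩ := isHaarMeasure_isInvInvariant_map_subgroupCongrHomeomorph_conj (Quotient.out c) g x hx tc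
    haveI := hgH
    haveI := hgI
    refine ⟨_, hgH, hgI, map_cosetCongr_quotientMeasure (MulAut.conj x : G ≃* G) (continuous_mulAutConj x) (continuous_mulAutConj_symm x) _ _
      (forall_apply_mem_centralizer_singleton_iff_of_eq (MulAut.conj x) hx) _ _ ν ν rfl (map_mulAutConj_eq_self ν x).symm, ?_⟩
    intro hgK hKC
    -- the class meets `K` in the `P`-point `g`, so the base point lies in `K`
    have hgc : ConjClasses.mk g = c := by
      have h1 : ConjClasses.mk g = ConjClasses.mk (Quotient.out c) :=
        ConjClasses.mk_eq_mk_iff_isConj.2 (isConj_iff.2 ⟨x, by rw [← MulAut.conj_apply]; exact hx⟩).symm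
      rw [h1, ← ConjClasses.quotient_mk_eq_mk, Quotient.out_eq]
    have hg₀K : g₀ ∈ K := hK₀ ⟨g, hP, hgK, hgc⟩
    -- integral conjugacy: `k g k⁻¹ = g₀` with `k ∈ K`
    have hgg₀ : IsConj g g₀ := ConjClasses.mk_eq_mk_iff_isConj.1 (hgc.trans hc₀.symm)
    obtain ⟨k, hk, hkg⟩ := hKC g₀ hP₀ hg₀K hgg₀
    -- one transport along `x y₀`, which conjugates `g₀` to `g`
    have hxy : (MulAut.conj (x * y₀) : G ≃* G) g₀ = g := by
      rw [map_mul, MulAut.mul_apply, hy₀', hx]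
    have hcomp : Measure.map (subgroupCongrHomeomorph (MulAut.conj x : G ≃* G) _ (Subgroup.centralizer ({g} : Set G))
          (forall_apply_mem_centralizer_singleton_iff_of_eq (MulAut.conj x) hx) (continuous_mulAutConj x) (continuous_mulAutConj_symm x)) tc =
        Measure.map (subgroupCongrHomeomorph (MulAut.conj (x * y₀) : G ≃* G) _ (Subgroup.centralizer ({g} : Set G))
          (forall_apply_mem_centralizer_singleton_iff_of_eq (MulAut.conj (x * y₀)) hxy) (continuous_mulAutConj (x * y₀))
          (continuous_mulAutConj_symm (x * y₀))) t₀ := by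
      rw [htc, Measure.map_map (Homeomorph.measurable _) (Homeomorph.measurable _)]
      congr 1
      funext w
      apply Subtype.ext
      simp only [Function.comp_apply, coe_subgroupCongrHomeomorph_apply, MulAut.conj_apply]
      group
    rw [hcomp]
    -- `(x y₀) = k⁻¹ · (k x y₀)` with `k x y₀ ∈ C(g₀)`; the level mass is conjugation invariant on `C(g₀)`
    have hz : k⁻¹⁻¹ * (x * y₀) ∈ Subgroup.centralizer ({g₀} : Set G) := by
      rw [inv_inv, Subgroup.mem_centralizer_singleton_iff]
      have hxy' : x * y₀ * g₀ * (x * y₀)⁻¹ = g := by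
        have h := hxy
        rwa [MulAut.conj_apply] at h
      have h1 : k * (x * y₀) * g₀ * (k * (x * y₀))⁻¹ = g₀ := by
        calc k * (x * y₀) * g₀ * (k * (x * y₀))⁻¹ = k * (x * y₀ * g₀ * (x * y₀)⁻¹) * k⁻¹ := by group
          _ = g₀ := by rw [hxy', hkg]
      calc k * (x * y₀) * g₀ = k * (x * y₀) * g₀ * (k * (x * y₀))⁻¹ * (k * (x * y₀)) := by group
        _ = g₀ * (k * (x * y₀)) := by rw [h1]
    rw [map_subgroupCongrHomeomorph_conj_apply_preimage_eq g₀ g (x * y₀) hxy K hK k⁻¹ (K.inv_mem hk) hz t₀]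
    exact ht₀1
  -- the family and its properties at the `P`-points
  refine ⟨fun c => if hc : (∃ g, P g ∧ ConjClasses.mk g = c) then (hex c hc).choose else 0, fun g hg => ?_⟩
  have hc : ∃ g', P g' ∧ ConjClasses.mk g' = ConjClasses.mk g := ⟨g, hg, rfl⟩
  obtain ⟨hadm, hprop⟩ := (hex _ hc).choose_spec
  refine ⟨by simp only [dif_pos hc]; exact hadm, ?_⟩
  obtain ⟨t', h1, h2, hmap, hlev⟩ := hprop g hg (conjOut g) (conj_conjOut_out g)
  refine ⟨t', h1, h2, ?_, hlev⟩
  unfold OrbitalMeasureFamily.atPoint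
  simp only [dif_pos hc]
  exact hmap

end Generic

/-! ## §2 `U(H)(L⁺_v)` at the semisimple rational classes -/

namespace UnitaryGroup

variable (L : Type) [Field L] [NumberField L] [IsCMField L] {H : Matrix (Fin 3) (Fin 3) L}

/-- **Per finite place `v`: the level-normalised family of local orbital measures of `U(H)(L⁺_v)` at the semisimple rational classes.**  `H ∈ M₃(L)`
hermitian non-degenerate, `ν` a two-sided Haar measure on `U(H)(L⁺_v)`: there is `m : OrbitalMeasureFamily (U(H)(L⁺_v))` such that for every
SEMISIMPLE rational `γ` (regular, singular or central), with `γ_v = toLocal v (γ ⊗ 1)`: `m ⟦γ_v⟧` is non-zero, invariant, finite on compacta;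
`m.atPoint γ_v = ν ∕ t` for a Haar inversion-invariant `t` on `C(γ_v)` (unimodular: ★ `isMulRightInvariant_local_centralizer_toLocal_of_isSemisimpleElt`);
and `t(C(γ_v) ∩ K_v) = 1` as soon as `γ_v ∈ K_v = U(H)(𝒪_v)` and `γ` has Kottwitz's integral-conjugacy property at `v` (every `g′ ∈ K_v`
`GL₃(L ⊗ L⁺_v)`-conjugate to `γ_v` is `K_v`-conjugate to it). [cite: Rogawski1990, §4.3 pp. 43–44; §4.9 p. 54] [cite: Kottwitz1986, Prop. 7.1] -/
theorem exists_localOrbitalMeasureFamily_levelNormalised_of_isSemisimpleElt (hH : (H.map (cmConjRingHom L))ᵀ = H) (hdet : H.det ≠ 0)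
    (v : HeightOneSpectrum (𝓞 ↥(maximalRealSubfield L)))
    [MeasurableSpace ((cmDatum L 3 H).Local v)] [BorelSpace ((cmDatum L 3 H).Local v)]
    [∀ g : (cmDatum L 3 H).Local v, MeasurableSpace (((cmDatum L 3 H).Local v) ⧸ Subgroup.centralizer ({g} : Set ((cmDatum L 3 H).Local v)))]
    [∀ g : (cmDatum L 3 H).Local v, BorelSpace (((cmDatum L 3 H).Local v) ⧸ Subgroup.centralizer ({g} : Set ((cmDatum L 3 H).Local v)))]
    (ν : Measure ((cmDatum L 3 H).Local v)) [ν.IsHaarMeasure] [ν.IsMulRightInvariant] :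
    ∃ m : OrbitalMeasureFamily ((cmDatum L 3 H).Local v), ∀ γ : (cmDatum L 3 H).Rational, Rogawski1990.IsSemisimpleElt (cmConjRingHom L) H γ →
      (m (ConjClasses.mk ((cmDatum L 3 H).toLocal v ((cmDatum L 3 H).toAdelic γ))) ≠ 0 ∧
        SMulInvariantMeasure ((cmDatum L 3 H).Local v) _ (m (ConjClasses.mk ((cmDatum L 3 H).toLocal v ((cmDatum L 3 H).toAdelic γ)))) ∧
        IsFiniteMeasureOnCompacts (m (ConjClasses.mk ((cmDatum L 3 H).toLocal v ((cmDatum L 3 H).toAdelic γ))))) ∧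
      ∃ t : Measure (Subgroup.centralizer ({(cmDatum L 3 H).toLocal v ((cmDatum L 3 H).toAdelic γ)} : Set ((cmDatum L 3 H).Local v))),
        ∃ (_ : t.IsHaarMeasure) (_ : t.IsInvInvariant),
          m.atPoint ((cmDatum L 3 H).toLocal v ((cmDatum L 3 H).toAdelic γ)) =
            quotientMeasure (Subgroup.centralizer ({(cmDatum L 3 H).toLocal v ((cmDatum L 3 H).toAdelic γ)} : Set ((cmDatum L 3 H).Local v))) t
              (isClosed_coe_centralizer_singleton _) ν ∧
          ((cmDatum L 3 H).toLocal v ((cmDatum L 3 H).toAdelic γ) ∈ cmLocalIntegralLevel L 3 H v →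
            (∀ g' : (cmDatum L 3 H).Local v, g' ∈ cmLocalIntegralLevel L 3 H v →
              IsConj (g'.val : GL (Fin 3) (LocalRing L v)) (((cmDatum L 3 H).toLocal v ((cmDatum L 3 H).toAdelic γ)).val : GL (Fin 3) (LocalRing L v)) →
                ∃ k ∈ cmLocalIntegralLevel L 3 H v, k * (cmDatum L 3 H).toLocal v ((cmDatum L 3 H).toAdelic γ) * k⁻¹ = g') →
            t (Subtype.val ⁻¹' (cmLocalIntegralLevel L 3 H v : Set ((cmDatum L 3 H).Local v))) = 1) := by
  have hP : ∀ g : (cmDatum L 3 H).Local v,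
      (∃ γ : (cmDatum L 3 H).Rational, Rogawski1990.IsSemisimpleElt (cmConjRingHom L) H γ ∧ (cmDatum L 3 H).toLocal v ((cmDatum L 3 H).toAdelic γ) = g) →
        ∀ (ρ : Measure (Subgroup.centralizer ({g} : Set ((cmDatum L 3 H).Local v)))) [ρ.IsHaarMeasure], ρ.IsMulRightInvariant := by
    rintro g ⟨γ, hss, rfl⟩ ρ _
    exact isMulRightInvariant_local_centralizer_toLocal_of_isSemisimpleElt hH hdet v γ hss ρ
  obtain ⟨m, hm⟩ := exists_orbitalMeasureFamily_atPoint_eq_quotientMeasure_levelNormalised ν (cmLocalIntegralLevel L 3 H v)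
    (isCompact_isOpen_cmLocalIntegralLevel L 3 H v).2 (isCompact_isOpen_cmLocalIntegralLevel L 3 H v).1 _ hP
  refine ⟨m, fun γ hγ => ?_⟩
  obtain ⟨hadm, t, htH, htI, hat, hlev⟩ := hm _ ⟨γ, hγ, rfl⟩
  refine ⟨hadm, t, htH, htI, hat, fun hK hKC => hlev hK fun g' _ hg'K hconj => hKC g' hg'K ?_⟩
  exact (MonoidHom.map_isConj («local» L (IsCMField.complexConj L) 3 H v).subtype hconj).symm

/-- **All finite places at once, with the exceptional set of each semisimple rational element** — the point data of FILE A
`UnitaryGroup.exists_tower_ofLocal_eq_quotientMeasure_of_atPoint_eq`: for two-sided local Haar measures `ν_v` there are class-indexed families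
`mG v` such that for every SEMISIMPLE rational `γ`: the members `mG v ⟦γ_v⟧` are admissible (all `v`), `(mG v).atPoint γ_v = ν_v ∕ t_v` for Haar
inversion-invariant `t_v` on `C(γ_v)` (all `v`), and `t_v(C(γ_v) ∩ K_v) = 1` off a finite set `S₀(γ)` — the places where `γ_v ∉ K_v`
(★ `Rogawski1990.eventually_toLocal_mem_cmLocalIntegralLevel`) or integral conjugacy fails (★ `Rogawski1990.eventually_forall_integralConj_cmDatum_of_isSemisimpleElt`).
[cite: Rogawski1990, §4.3 pp. 43–44; §4.9 p. 54] [cite: Kottwitz1986, Prop. 7.1; §7.3] -/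
theorem exists_localOrbitalMeasureFamilies_levelNormalised_of_isSemisimpleElt (hH : (H.map (cmConjRingHom L))ᵀ = H) (hdet : H.det ≠ 0)
    [∀ v, MeasurableSpace ((cmDatum L 3 H).Local v)] [∀ v, BorelSpace ((cmDatum L 3 H).Local v)]
    [∀ (v : HeightOneSpectrum (𝓞 ↥(maximalRealSubfield L))) (g : (cmDatum L 3 H).Local v),
      MeasurableSpace (((cmDatum L 3 H).Local v) ⧸ Subgroup.centralizer ({g} : Set ((cmDatum L 3 H).Local v)))]
    [∀ (v : HeightOneSpectrum (𝓞 ↥(maximalRealSubfield L))) (g : (cmDatum L 3 H).Local v),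
      BorelSpace (((cmDatum L 3 H).Local v) ⧸ Subgroup.centralizer ({g} : Set ((cmDatum L 3 H).Local v)))]
    (ν : ∀ v, Measure ((cmDatum L 3 H).Local v)) [∀ v, (ν v).IsHaarMeasure] [∀ v, (ν v).IsMulRightInvariant] :
    ∃ mG : ∀ v, OrbitalMeasureFamily ((cmDatum L 3 H).Local v), ∀ γ : (cmDatum L 3 H).Rational,
      Rogawski1990.IsSemisimpleElt (cmConjRingHom L) H γ →
        (∀ v, mG v (ConjClasses.mk ((cmDatum L 3 H).toLocal v ((cmDatum L 3 H).toAdelic γ))) ≠ 0 ∧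
          SMulInvariantMeasure ((cmDatum L 3 H).Local v) _ (mG v (ConjClasses.mk ((cmDatum L 3 H).toLocal v ((cmDatum L 3 H).toAdelic γ)))) ∧
          IsFiniteMeasureOnCompacts (mG v (ConjClasses.mk ((cmDatum L 3 H).toLocal v ((cmDatum L 3 H).toAdelic γ))))) ∧
        ∃ (S₀ : Finset (HeightOneSpectrum (𝓞 ↥(maximalRealSubfield L))))
          (t : ∀ v, Measure (Subgroup.centralizer ({(cmDatum L 3 H).toLocal v ((cmDatum L 3 H).toAdelic γ)} : Set ((cmDatum L 3 H).Local v)))),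
          ∃ (_ : ∀ v, (t v).IsHaarMeasure) (_ : ∀ v, (t v).IsInvInvariant),
            (∀ v, (mG v).atPoint ((cmDatum L 3 H).toLocal v ((cmDatum L 3 H).toAdelic γ)) =
              quotientMeasure (Subgroup.centralizer ({(cmDatum L 3 H).toLocal v ((cmDatum L 3 H).toAdelic γ)} : Set ((cmDatum L 3 H).Local v)))
                (t v) (isClosed_coe_centralizer_singleton _) (ν v)) ∧
            ∀ v, v ∉ S₀ → t v (Subtype.val ⁻¹' (cmLocalIntegralLevel L 3 H v : Set ((cmDatum L 3 H).Local v))) = 1 := by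
  classical
  choose m hm using fun v => exists_localOrbitalMeasureFamily_levelNormalised_of_isSemisimpleElt L hH hdet v (ν v)
  refine ⟨m, fun γ hγ => ⟨fun v => (hm v γ hγ).1, ?_⟩⟩
  choose t htH htI hat hlev using fun v => (hm v γ hγ).2
  -- the exceptional set: `γ_v ∉ K_v` or integral conjugacy fails
  have hev := (Rogawski1990.eventually_forall_integralConj_cmDatum_of_isSemisimpleElt L H hH hdet γ hγ).and
    (Rogawski1990.eventually_toLocal_mem_cmLocalIntegralLevel ((cmDatum L 3 H).toAdelic γ))
  rw [Filter.eventually_cofinite] at hev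
  refine ⟨hev.toFinset, t, htH, htI, hat, fun v hv => ?_⟩
  have hv' := mt hev.mem_toFinset.2 hv
  simp only [Set.mem_setOf_eq, not_not] at hv'
  exact hlev v hv'.2 hv'.1


/-- **(ED. 2) … and NORMALISED OFF A FINITE SET at every semisimple rational point.**  With `ν_v(K_v) = 1` the families of
`exists_localOrbitalMeasureFamilies_levelNormalised_of_isSemisimpleElt` satisfy, at every SEMISIMPLE rational `γ`, besides admissibility and the
point data `(S₀, t, hat, ht1K)`, the normalisation `∃ S₀, IsNormalisedOff L 3 H mG (γ ⊗ 1) S₀` — `(ν_v ∕ t_v)(π K_v) = ν_v(K_v) ∕ t_v(C(γ_v) ∩ K_v) = 1`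
off `S₀(γ)` (★ `quotientMeasure_image_mk_eq_one`): the base-point binder `hnormγ′` of ★ (SA-st)
`adelicStableOrbitalSum_classesSelf_eq_adelicStableOrbitalIntegralG_of_mul_sub_eq_zero` ∕ ★ (ζ1″ §4) for the singular-class local data of the T1 line's
patched kit family (O7 OWNER WORD #18, row (ANCHOR-s)). [cite: Rogawski1990, §4.3 pp. 43–44; §5.4 p. 72] [cite: DeitmarEchterhoff2014, Thm. 1.5.3] -/
theorem exists_localOrbitalMeasureFamilies_levelNormalised_isNormalisedOff (hH : (H.map (cmConjRingHom L))ᵀ = H) (hdet : H.det ≠ 0)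
    [∀ v, MeasurableSpace ((cmDatum L 3 H).Local v)] [∀ v, BorelSpace ((cmDatum L 3 H).Local v)]
    [∀ (v : HeightOneSpectrum (𝓞 ↥(maximalRealSubfield L))) (g : (cmDatum L 3 H).Local v),
      MeasurableSpace (((cmDatum L 3 H).Local v) ⧸ Subgroup.centralizer ({g} : Set ((cmDatum L 3 H).Local v)))]
    [∀ (v : HeightOneSpectrum (𝓞 ↥(maximalRealSubfield L))) (g : (cmDatum L 3 H).Local v),
      BorelSpace (((cmDatum L 3 H).Local v) ⧸ Subgroup.centralizer ({g} : Set ((cmDatum L 3 H).Local v)))]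
    (ν : ∀ v, Measure ((cmDatum L 3 H).Local v)) [∀ v, (ν v).IsHaarMeasure] [∀ v, (ν v).IsMulRightInvariant]
    (hK : ∀ v, ν v (cmLocalIntegralLevel L 3 H v : Set ((cmDatum L 3 H).Local v)) = 1) :
    ∃ mG : ∀ v, OrbitalMeasureFamily ((cmDatum L 3 H).Local v), ∀ γ : (cmDatum L 3 H).Rational,
      Rogawski1990.IsSemisimpleElt (cmConjRingHom L) H γ →
        (∀ v, mG v (ConjClasses.mk ((cmDatum L 3 H).toLocal v ((cmDatum L 3 H).toAdelic γ))) ≠ 0 ∧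
          SMulInvariantMeasure ((cmDatum L 3 H).Local v) _ (mG v (ConjClasses.mk ((cmDatum L 3 H).toLocal v ((cmDatum L 3 H).toAdelic γ)))) ∧
          IsFiniteMeasureOnCompacts (mG v (ConjClasses.mk ((cmDatum L 3 H).toLocal v ((cmDatum L 3 H).toAdelic γ))))) ∧
        (∃ (S₀ : Finset (HeightOneSpectrum (𝓞 ↥(maximalRealSubfield L))))
          (t : ∀ v, Measure (Subgroup.centralizer ({(cmDatum L 3 H).toLocal v ((cmDatum L 3 H).toAdelic γ)} : Set ((cmDatum L 3 H).Local v)))),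
          ∃ (_ : ∀ v, (t v).IsHaarMeasure) (_ : ∀ v, (t v).IsInvInvariant),
            (∀ v, (mG v).atPoint ((cmDatum L 3 H).toLocal v ((cmDatum L 3 H).toAdelic γ)) =
              quotientMeasure (Subgroup.centralizer ({(cmDatum L 3 H).toLocal v ((cmDatum L 3 H).toAdelic γ)} : Set ((cmDatum L 3 H).Local v)))
                (t v) (isClosed_coe_centralizer_singleton _) (ν v)) ∧
            ∀ v, v ∉ S₀ → t v (Subtype.val ⁻¹' (cmLocalIntegralLevel L 3 H v : Set ((cmDatum L 3 H).Local v))) = 1) ∧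
        ∃ S₀ : Finset (HeightOneSpectrum (𝓞 ↥(maximalRealSubfield L))), IsNormalisedOff L 3 H mG ((cmDatum L 3 H).toAdelic γ) S₀ := by
  obtain ⟨mG, hmG⟩ := exists_localOrbitalMeasureFamilies_levelNormalised_of_isSemisimpleElt L hH hdet ν
  refine ⟨mG, fun γ hγ => ?_⟩
  obtain ⟨hadm, S₀, t, htH, htI, hat, ht1⟩ := hmG γ hγ
  refine ⟨hadm, ⟨S₀, t, htH, htI, hat, ht1⟩, S₀, fun v hv => ?_⟩
  have hZc : IsClosed ((Subgroup.centralizer ({(cmDatum L 3 H).toLocal v ((cmDatum L 3 H).toAdelic γ)} : Set ((cmDatum L 3 H).Local v)) :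
      Subgroup ((cmDatum L 3 H).Local v)) : Set ((cmDatum L 3 H).Local v)) := isClosed_coe_centralizer_singleton _
  haveI : LocallyCompactSpace (Subgroup.centralizer ({(cmDatum L 3 H).toLocal v ((cmDatum L 3 H).toAdelic γ)} : Set ((cmDatum L 3 H).Local v))) :=
    hZc.isClosedEmbedding_subtypeVal.locallyCompactSpace
  haveI : SecondCountableTopology (Subgroup.centralizer ({(cmDatum L 3 H).toLocal v ((cmDatum L 3 H).toAdelic γ)} : Set ((cmDatum L 3 H).Local v))) :=
    TopologicalSpace.Subtype.secondCountableTopology _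
  haveI : SigmaCompactSpace (Subgroup.centralizer ({(cmDatum L 3 H).toLocal v ((cmDatum L 3 H).toAdelic γ)} : Set ((cmDatum L 3 H).Local v))) :=
    sigmaCompactSpace_of_locallyCompact_secondCountable
  haveI := htH v
  haveI := htI v
  rw [hat v]
  exact quotientMeasure_image_mk_eq_one _ (t v) (ν v) (cmLocalIntegralLevel L 3 H v) (isCompact_isOpen_cmLocalIntegralLevel L 3 H v).2
    (hK v) (ht1 v hv)

end UnitaryGroup

end Literature.NumberTheory.Automorphic
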